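import Summits.QuantumFields.YangMills.Theorems.AlphaInputsT3ACv3NewtonLiftRegionalWindow
import HarnessLib

/-!
# `AlphaInputsT3ACv3NewtonLiftRegionalKFree` — STRATEGY B for 2′, the (FL) row under OWNER RULING g24-№4 and RULING (FL-SMALL) 03:29Z: **THE REGIONAL NEWTON LIFT WITH EVERY SMALLNESS ROW A
# k-FREE NUMERAL INEQUALITY** — the end-to-end theorem `exists_exact_lift_regional_window_allL` re-read on the natural scales `r = t∕L^k` (radius), `η = x∕L^k` (stencil-gauge flatness):
# the seven smallness rows become inequalities among the NUMERALS `t, x, η₀, κ` and the constants `d, L, |n|, C_R, C_A(L,d), ℓ = (d+2)L, δ_N` with NO `k` — so the (FL) supplier reads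
# off ONE absolute `ε_FL` once `x = X·ε′`, `η₀ = A₀·ε′` — lane `pub-balaban3d` ∕ cell `ym3-torus`, seat `ym-ust-19936-w4` (g2)

WHY (cell `ym3-torus` 2026-08-28: ★★OWNER g25 RULING (FL-SMALL) 03:29:46Z «every (FL) knit carries the explicit binder `(hε : ε′ ≤ ε_FL)` with `ε_FL` a CLOSED NUMERAL (★w4: display (D)∕(E′)∕log-window
smallness rows as numerals so ε_FL is read off; B absolute either way)»; ★w1-19936 g2 LEAD LOCATED FL-SMALL «★w4's (D) contraction `κ + (d+1)·C_R·β′ ≤ ½` and the flat rows at `η = S·δ₀`,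
`η₀ ≈ 10⁹·ε′` are the binding ones»).  The rows of `exists_exact_lift_regional_window_allL` (this seat, p601499) are written in `m′(x) = (d+1)L^k·x`; on the scales the START delivers
(`r·L^k`, `η·L^k`, `η₀` all `k`-free) every `L^k` cancels.  THIS FILE records that cancellation once:
* ★★★ `exists_exact_lift_regional_window_kfree` — same data and conclusion as `exists_exact_lift_regional_window_allL` with radius `r := t∕L^k` and flatness `x∕L^k`, under the k-FREE rows
  (K1) `C_A·(d+1)·(6t + x) ≤ 1`, (K2) `200ℓ·(d+1)·(6t + x) ≤ 1`, (K3) `4ℓ·(d+1)·(6t + x) < δ_N`, (K4) `4(d+1)t + η₀ ≤ 1∕4`, (K5) `|n|·(4(d+1)t + η₀) < π`,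
  (K6) `κ + (d+1)·C_R·(8(4(d+1)t + η₀) + 2C_A(d+1)(6t + x) + (2t + x) + (2(d+1)x + η₀)) ≤ 1∕2`, (K7) `4C_R·η₀ ≤ t`, with `0 < t ≤ 1∕4`, `0 ≤ x` — each LINEAR in `(t, x, η₀, κ)`, so with
  `x = X·ε′`, `η₀ = A₀·ε′`, `t` a fixed numeral and `κ ≤ ¼` they all read `ε′ ≤ ε_FL(d, L, |n|, C_R, X, A₀)`.
HONEST FRAMING.  Pure re-scaling over (E′); every analytic input (START, kernel certificate) stays DISPLAYED; `hLift`, the stub 2′χ, the crux `HistoryTailL` and any gap are NOT claimed;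
count-neutral helper toward R3 2′ (items 19936∕19935); registry untouched; nothing about d = 4, the continuum, or a mass gap; YM₃ on T³ is rung R3, not Clay.

References: T. Bałaban, Commun. Math. Phys. 102 (1985) 277–309 [Balaban1985Variational] (Thm 1 (8) p.279, (11)–(15) pp.279–280); CMP 98 (1985) 17–51 [Balaban1985Averaging] (Props. 4–5
pp.38–42, (20)–(23) p.21).
-/

set_option autoImplicit false

noncomputable section

open scoped Matrix.Norms.L2Operator
open NormedSpace
namespace Summit.QuantumFields.YangMills.Theorems.NewtonLiftFramed

open Literature.MathematicalPhysics.QuantumFieldTheory.Balaban1983to89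
open Literature.MathematicalPhysics.QuantumFieldTheory.Balaban1983to89.T4AdjointCovarianceUnitary (lieSU)
open Literature.MathematicalPhysics.QuantumFieldTheory.Balaban1983to89.B5Eq118OneStroke (iterBlockOf)
open T4Continuum BlockAveraging ExpMeanLog
open Summit.QuantumFields.YangMills.Theorems.LinearLiftMatrix (linAvgIterM curlM)

variable {n : Type*} [Fintype n] [DecidableEq n] [Nonempty n] {P : Params}

/-- **★★★ THE REGIONAL NEWTON LIFT, k-FREE SMALLNESS ROWS** (every `L ≥ 2`, `k ≤ m + K`).  Data as in `exists_exact_lift_regional_window_allL` (constrained set `C`, stencil gauges `σ` with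
stencils `N ⊇` the two `k`-blocks, `U₀`, `V`, abstract kernel `R₀` with rows (α)(β)(γ), plaquette set `Pl` with gauges `g`, START bound `δ₀`, curl row `C_curl`, scales `ε, B₀, A₀, A₁`), the
stencil flatness written `‖(U₀^{σ_c})_b − 1‖ ≤ x∕L^k` and the shell's radius `t∕L^k`; smallness as the k-FREE NUMERAL ROWS (K1)–(K7) of the module docstring (`C_A = (d+1)C_S·5200ℓ²∕(L(L−1))`,
`ℓ = (d+2)L`, `δ_N = deltaSU n`).  THEN the exact lift `U = e^{R₀u}U₀` (`Ū^{(k)} = V` on `C`, `‖u‖ ≤ 4η₀`, `‖(R₀u)_b‖ ≤ 4C_Rη₀∕L^k`) with `dist1 U(∂q) ≤ (B₀ + 4C_curl A₀ + 64C_R A₁A₀ + 256C_R²A₀²)·ε∕(L^k)²`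
on `Pl`. [cite: Balaban1985Variational, Thm 1 (8) p.279, (11)–(15) pp.279–280; Balaban1985Averaging, Props. 4–5 pp.38–42] -/
theorem exists_exact_lift_regional_window_kfree {k : ℕ} (hk : k ≤ P.m + P.K) (C : Set (PBond P k))
    (σ : PBond P k → GaugeTransf P 0 (Matrix.specialUnitaryGroup n ℂ)) (N : PBond P k → Set (Site P 0))
    (hN : ∀ c ∈ C, ∀ x : Site P 0, (iterBlockOf k x = c.src ∨ iterBlockOf k x = c.tgt) → x ∈ N c)
    (U₀ : GaugeField P 0 (Matrix.specialUnitaryGroup n ℂ)) (V : GaugeField P k (Matrix.specialUnitaryGroup n ℂ))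
    (R₀ : (PBond P k → Matrix n n ℂ) →ₗ[ℝ] (PBond P 0 → Matrix n n ℂ))
    {t x η₀ CR κ : ℝ} (ht : 0 < t) (ht4 : t ≤ 1 / 4) (hx : 0 ≤ x) (hη₀ : 0 ≤ η₀) (hCR : 0 < CR) (hκ : 0 ≤ κ)
    (hU₀ : ∀ c ∈ C, ∀ b : PBond P 0, b.src ∈ N c → b.tgt ∈ N c →
      ‖((GaugeField.gaugeAct (σ c) U₀ b : Matrix.specialUnitaryGroup n ℂ) : Matrix n n ℂ) - 1‖ ≤ x / (P.L : ℝ) ^ k)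
    (hV : ∀ c ∈ C, ‖((Averaging.iter (fun i => blockAvg (P := P) (j := i) (expMeanLogSU (n := n))) k U₀ c : Matrix.specialUnitaryGroup n ℂ) : Matrix n n ℂ) *
        star ((V c : Matrix.specialUnitaryGroup n ℂ) : Matrix n n ℂ) - 1‖ ≤ η₀)
    (hRS : ∀ u : PBond P k → Matrix n n ℂ, (∀ c, u c ∈ lieSU n) → (∀ c, c ∉ C → u c = 0) → ∀ b, R₀ u b ∈ lieSU n)
    (hRn : ∀ u : PBond P k → Matrix n n ℂ, (∀ c, u c ∈ lieSU n) → (∀ c, c ∉ C → u c = 0) → ‖R₀ u‖ ≤ (CR / (P.L : ℝ) ^ k) * ‖u‖)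
    (hRinv : ∀ u : PBond P k → Matrix n n ℂ, (∀ c, u c ∈ lieSU n) → (∀ c, c ∉ C → u c = 0) → ∀ c ∈ C,
      ‖star (transfUp (σ c) k c.src : Matrix n n ℂ) * linAvgIterM k (fun b => ((σ c b.src : Matrix.specialUnitaryGroup n ℂ) : Matrix n n ℂ) * R₀ u b * star (σ c b.src : Matrix n n ℂ)) c *
          (transfUp (σ c) k c.src : Matrix n n ℂ) - u c‖ ≤ κ * ‖u‖)
    -- the k-FREE numeral rows
    (K1 : (((P.d : ℝ) + 1) * ((18 : ℝ) ^ P.d * (2 + ((P.d : ℝ) + 1) * (18 : ℝ) ^ P.d)) * (5200 * (((P.d + 2) * P.L : ℕ) : ℝ) ^ 2) / ((P.L : ℝ) * ((P.L : ℝ) - 1))) *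
      (((P.d : ℝ) + 1) * (6 * t + x)) ≤ 1)
    (K2 : 200 * (((P.d + 2) * P.L : ℕ) : ℝ) * (((P.d : ℝ) + 1) * (6 * t + x)) ≤ 1)
    (K3 : 4 * (((P.d + 2) * P.L : ℕ) : ℝ) * (((P.d : ℝ) + 1) * (6 * t + x)) < deltaSU n)
    (K4 : 4 * ((P.d : ℝ) + 1) * t + η₀ ≤ 1 / 4)
    (K5 : (Fintype.card n : ℝ) * (4 * ((P.d : ℝ) + 1) * t + η₀) < Real.pi)
    (K6 : κ + ((P.d : ℝ) + 1) * CR *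
      (8 * (4 * ((P.d : ℝ) + 1) * t + η₀) +
        2 * (((P.d : ℝ) + 1) * ((18 : ℝ) ^ P.d * (2 + ((P.d : ℝ) + 1) * (18 : ℝ) ^ P.d)) * (5200 * (((P.d + 2) * P.L : ℕ) : ℝ) ^ 2) / ((P.L : ℝ) * ((P.L : ℝ) - 1))) *
          (((P.d : ℝ) + 1) * (6 * t + x)) +
        (2 * t + x) + (2 * (((P.d : ℝ) + 1) * x) + η₀)) ≤ 1 / 2)
    (K7 : 4 * CR * η₀ ≤ t)
    -- the plaquette data and the scales
    (Pl : Set (Plaq P 0)) (g : Plaq P 0 → GaugeTransf P 0 (Matrix.specialUnitaryGroup n ℂ)) {ηp δ₀ Ccurl : ℝ} (hCcurl : 0 ≤ Ccurl)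
    (hU₀P : ∀ q ∈ Pl,
      ‖((GaugeField.gaugeAct (g q) U₀ ⟨q.src, q.μ⟩ : Matrix.specialUnitaryGroup n ℂ) : Matrix n n ℂ) - 1‖ ≤ ηp ∧
      ‖((GaugeField.gaugeAct (g q) U₀ ⟨q.src.shift q.μ, q.ν⟩ : Matrix.specialUnitaryGroup n ℂ) : Matrix n n ℂ) - 1‖ ≤ ηp ∧
      ‖((GaugeField.gaugeAct (g q) U₀ ⟨q.src.shift q.ν, q.μ⟩ : Matrix.specialUnitaryGroup n ℂ) : Matrix n n ℂ) - 1‖ ≤ ηp ∧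
      ‖((GaugeField.gaugeAct (g q) U₀ ⟨q.src, q.ν⟩ : Matrix.specialUnitaryGroup n ℂ) : Matrix n n ℂ) - 1‖ ≤ ηp)
    (hstart : ∀ q ∈ Pl, GaugeGroup.dist1 (GaugeField.plaqHol U₀ q) ≤ δ₀)
    (hRcurl : ∀ u : PBond P k → Matrix n n ℂ, (∀ c, u c ∈ lieSU n) → (∀ c, c ∉ C → u c = 0) → ∀ q ∈ Pl,
      ‖curlM (fun b : PBond P 0 => ((g q b.src : Matrix.specialUnitaryGroup n ℂ) : Matrix n n ℂ) * R₀ u b * star (g q b.src : Matrix n n ℂ)) q.src q.μ q.ν‖ ≤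
        (Ccurl / ((P.L : ℝ) ^ k) ^ 2) * ‖u‖)
    {ε B₀ A₀ A₁ : ℝ} (hε : 0 ≤ ε) (hε1 : ε ≤ 1) (hA₀ : 0 ≤ A₀) (hA₁ : 0 ≤ A₁)
    (hδ₀ : δ₀ ≤ B₀ * (ε / ((P.L : ℝ) ^ k) ^ 2)) (hη₀A : η₀ ≤ A₀ * ε) (hηpA : ηp ≤ A₁ * (ε / (P.L : ℝ) ^ k)) :
    ∃ (U : GaugeField P 0 (Matrix.specialUnitaryGroup n ℂ)) (u : PBond P k → Matrix n n ℂ) (a : PBond P 0 → Matrix n n ℂ),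
      (∀ c, u c ∈ lieSU n) ∧ (∀ c, c ∉ C → u c = 0) ∧ ‖u‖ ≤ 4 * η₀ ∧ a = R₀ u ∧ (∀ b, a b ∈ lieSU n) ∧
      (∀ b, ‖a b‖ ≤ 4 * CR * η₀ / (P.L : ℝ) ^ k) ∧
      (∀ b, ((U b : Matrix.specialUnitaryGroup n ℂ) : Matrix n n ℂ) = exp (a b) * (U₀ b : Matrix n n ℂ)) ∧
      (∀ c ∈ C, Averaging.iter (fun i => blockAvg (P := P) (j := i) (expMeanLogSU (n := n))) k U c = V c) ∧
      (∀ q ∈ Pl, GaugeGroup.dist1 (GaugeField.plaqHol U q) ≤ (B₀ + 4 * Ccurl * A₀ + 64 * CR * A₁ * A₀ + 256 * CR ^ 2 * A₀ ^ 2) * (ε / ((P.L : ℝ) ^ k) ^ 2)) := by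
  -- the scales
  set Lk : ℝ := (P.L : ℝ) ^ k with hLk
  have hL1 : (1 : ℝ) ≤ (P.L : ℝ) := by exact_mod_cast P.hL.2.le
  have hLk1 : 1 ≤ Lk := by rw [hLk]; exact one_le_pow₀ hL1
  have hLk0 : 0 < Lk := by linarith
  set r : ℝ := t / Lk with hr
  set η : ℝ := x / Lk with hη
  have hr0 : 0 < r := by rw [hr]; positivity
  have hη0 : 0 ≤ η := by rw [hη]; positivity
  have hrt : Lk * r = t := by rw [hr]; field_simp
  have hηx : Lk * η = x := by rw [hη]; field_simp
  have hr_le_t : r ≤ t := by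
    rw [hr, div_le_iff₀ hLk0]; nlinarith
  have hη_le_x : η ≤ x := by
    rw [hη, div_le_iff₀ hLk0]; nlinarith
  have hr4 : r ≤ 1 / 4 := hr_le_t.trans ht4
  have hA0 : 0 ≤ (P.d : ℝ) + 1 := by positivity
  -- the `m′`-letters on the scales
  have hm4 : ((P.d : ℝ) + 1) * Lk * (4 * r) = ((P.d : ℝ) + 1) * (4 * t) := by
    rw [show ((P.d : ℝ) + 1) * Lk * (4 * r) = ((P.d : ℝ) + 1) * (4 * (Lk * r)) by ring, hrt]
  have hm2η : ((P.d : ℝ) + 1) * Lk * (2 * r + η) = ((P.d : ℝ) + 1) * (2 * t + x) := by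
    rw [show ((P.d : ℝ) + 1) * Lk * (2 * r + η) = ((P.d : ℝ) + 1) * (2 * (Lk * r) + Lk * η) by ring, hrt, hηx]
  have hm2 : ((P.d : ℝ) + 1) * Lk * (2 * r) = ((P.d : ℝ) + 1) * (2 * t) := by
    rw [show ((P.d : ℝ) + 1) * Lk * (2 * r) = ((P.d : ℝ) + 1) * (2 * (Lk * r)) by ring, hrt]
  have hmη : ((P.d : ℝ) + 1) * Lk * η = ((P.d : ℝ) + 1) * x := by
    rw [mul_assoc, hηx]
  have hsum : ((P.d : ℝ) + 1) * Lk * (4 * r) + ((P.d : ℝ) + 1) * Lk * (2 * r + η) = ((P.d : ℝ) + 1) * (6 * t + x) := by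
    rw [hm4, hm2η]; ring
  have hρ : 2 * (((P.d : ℝ) + 1) * Lk * (2 * r)) + η₀ = 4 * ((P.d : ℝ) + 1) * t + η₀ := by rw [hm2]; ring
  -- the seven rows of (E′) from (K1)–(K7)
  have h5200 : (((P.d : ℝ) + 1) * ((18 : ℝ) ^ P.d * (2 + ((P.d : ℝ) + 1) * (18 : ℝ) ^ P.d)) * (5200 * (((P.d + 2) * P.L : ℕ) : ℝ) ^ 2) / ((P.L : ℝ) * ((P.L : ℝ) - 1))) *
      ((((P.d : ℝ) + 1) * Lk * (4 * r)) + (((P.d : ℝ) + 1) * Lk * (2 * r + η))) ≤ 1 := by rw [hsum]; exact K1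
  have h200 : 200 * (((P.d + 2) * P.L : ℕ) : ℝ) * ((((P.d : ℝ) + 1) * Lk * (4 * r)) + (((P.d : ℝ) + 1) * Lk * (2 * r + η))) ≤ 1 := by rw [hsum]; exact K2
  have hNδ : 4 * (((P.d + 2) * P.L : ℕ) : ℝ) * ((((P.d : ℝ) + 1) * Lk * (4 * r)) + (((P.d : ℝ) + 1) * Lk * (2 * r + η))) < deltaSU n := by rw [hsum]; exact K3
  have hρD : 2 * ((((P.d : ℝ) + 1) * Lk * (2 * r))) + η₀ ≤ 1 / 4 := by rw [hρ]; exact K4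
  have hρπ : (Fintype.card n : ℝ) * (2 * ((((P.d : ℝ) + 1) * Lk * (2 * r))) + η₀) < Real.pi := by rw [hρ]; exact K5
  have hcontr : κ + ((P.d : ℝ) + 1) * CR *
      (8 * (2 * ((((P.d : ℝ) + 1) * Lk * (2 * r))) + η₀) +
          2 * (((P.d : ℝ) + 1) * ((18 : ℝ) ^ P.d * (2 + ((P.d : ℝ) + 1) * (18 : ℝ) ^ P.d)) * (5200 * (((P.d + 2) * P.L : ℕ) : ℝ) ^ 2) / ((P.L : ℝ) * ((P.L : ℝ) - 1))) *
            ((((P.d : ℝ) + 1) * Lk * (4 * r)) + (((P.d : ℝ) + 1) * Lk * (2 * r + η))) +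
          (2 * r + η) + (2 * ((((P.d : ℝ) + 1) * Lk * η)) + η₀)) ≤ 1 / 2 := by
    rw [hρ, hsum, hmη]
    refine le_trans ?_ K6
    have h1 : 2 * r + η ≤ 2 * t + x := by linarith
    have hC : 0 ≤ ((P.d : ℝ) + 1) * CR := by positivity
    refine add_le_add le_rfl (mul_le_mul_of_nonneg_left ?_ hC)
    linarith
  have hdef : 4 * CR * η₀ ≤ r * Lk := by rw [mul_comm r Lk, hrt]; exact K7
  have hU₀' : ∀ c ∈ C, ∀ b : PBond P 0, b.src ∈ N c → b.tgt ∈ N c →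
      ‖((GaugeField.gaugeAct (σ c) U₀ b : Matrix.specialUnitaryGroup n ℂ) : Matrix n n ℂ) - 1‖ ≤ η := fun c hc b h1 h2 => by rw [hη, hLk]; exact hU₀ c hc b h1 h2
  exact exists_exact_lift_regional_window_allL hk C σ N hN U₀ V R₀ hr0 hr4 hη0 hη₀ hCR hκ hU₀' hV hRS hRn hRinv h5200 h200 hNδ hρD hρπ hcontr hdef Pl g hCcurl hU₀P hstart hRcurl
    hε hε1 hA₀ hA₁ hδ₀ hη₀A hηpA

end Summit.QuantumFields.YangMills.Theorems.NewtonLiftFramed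

end
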